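import Summits.AnomalousDissipation.AnomalousDissipation.Theorems.SawtoothPulseCascadeK1LocalisedCascadeChirpSidebandEnergy
import Summits.AnomalousDissipation.AnomalousDissipation.Theorems.SawtoothPulseCascadeK1LocalisedCascadeFibreWindowL2

/-!
# K1loc, line `Spectral` / thin start — helper: THE HALF-STEP WINDOW INEQUALITY IN FIBRE-`L²` FORM (S-D, «HalfStepL2»)

Helper file of the prover lane on the crux `K1LocalisedCascade` (stmt-AnomalousDissipation-19491), route
`SawtoothPulseCascade` (S-D fibre ledger).  The fibre-`L²` twin of `…HalfStepVT.sum_window_sq_norm_vstep_twist_le`,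
for BOTH half-steps at once (shear `Φ = shearMap i i′ (γU_j)`, `i ≠ i′`; V: `i = 1, i′ = 0`; H: `i = 0, i′ = 1`) and a GENERIC
continuous input `b` with absolutely summable coefficients:
* the tracked part of the input is the axis cut-off `T = Σ_l χ(l)·A^{i′}_l b` (`χ` supported in `Sχ`, `‖χ‖ ≤ 1`,
  `χ(l) ≠ 0 → |l| < L`), the remainder `b − T` is paid in `L²` through its fibre pieces;
* on every fibre `n = k_i` of the window the chirp `g_n = twist(γU_j) n` is split as `ψ_n ⋆ g_n + (g_n − ψ_n ⋆ g_n)` with a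
  multiplier `ψ_n` supported in `Sψ n`, `‖ψ_n‖ ≤ 1`, equal to `1` on `k_{i′} − l`, `|l| < L` (EXACT SEPARATION, as in `…HalfStepVT`);
* the mid-band energy `E_n = ∫_𝕋‖ψ_n ⋆ g_n‖²` is NOT majorised pointwise but taken from `…ChirpSidebandEnergy`
  (`integral_norm_sq_circleCutoff_twist_cascade_le`): with `N_j·λ′_n = nG` and the notch `N_j·D′_n ≤ |m ± nG|` on the
  multiples `m ∈ Sψ n` of `N_j` (`D′_n ≥ 2`), `E_n ≤ (√((8/π²)/(D′_n−1)) + |n|G(2e^{1/2}−1)δ_j/N_j)²`;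
* the sup of the fibre coefficient of the tracked part, `‖A^i_n T‖ ≤ S_n`, stays a hypothesis (`…FibreSup`).
**`sum_window_sq_norm_halfStep_twist_L2_le`** —
`Σ_{k∈W}‖𝓕(b∘Φ)(k)‖² ≤ (√(Σ_{n∈F} E_n·S_n²) + √(Σ_{n∈F}∫‖A^i_n(b − T)‖²))²`, `F = {k_i : k ∈ W}`
(`…FibreWindowL2.sum_window_sq_norm_comp_shearMap_le_fibreL2`).
No definitions; no statement about the crux. [cite: Grafakos2014, Prop. 3.1.2 (5) and Prop. 3.2.7 (3)] [problem: turb]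
-/

-- `Summit.<Summit>.<Problem>`: single-conjunct summit, the duplicate namespace segment is deliberate.
set_option linter.dupNamespace false

noncomputable section

namespace Summit.AnomalousDissipation.AnomalousDissipation.Theorems.SawtoothPulseCascade.K1Window

open MeasureTheory Set Filter Topology UnitAddTorus Function Complex
open scoped Real
open Literature.Analysis Literature.Analysis.FunctionSpaces Literature.Analysis.FunctionSpaces.Torus Literature.Analysis.FluidPDE
open Literature.Analysis.FluidPDE.ShearStage
open Literature.Analysis.FluidPDE.SawtoothCascade Literature.Analysis.FluidPDE.SawtoothCascade.CascadeParams
open Summit.AnomalousDissipation.AnomalousDissipation.Theorems.SawtoothPulseCascade.K1Start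

/-! ## The half-step window inequality, fibre-`L²` form -/

/-- **THE HALF-STEP WINDOW INEQUALITY, FIBRE-`L²` FORM** (see the file header).  Data: cascade parameters (`γ = G ∈ ℕ`,
`δ₀ > 0`, `d > 0`, phase `j` with `N_j ≥ 1`), axes `i ≠ i′`, a continuous input `b` with absolutely summable coefficients, a
finite window `W`, the input cut-off `χ` (support `Sχ`, `‖χ‖ ≤ 1`, `χ(l) ≠ 0 → |l| < L`), per-fibre multipliers `ψ_n`
(support `Sψ n`, `‖ψ_n‖ ≤ 1` there, plateau `ψ_{k_i}(k_{i′} − l) = 1` for `k ∈ W`, `|l| < L`), reduced strains `λ′` with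
`N_j·λ′(k_i) = k_i·G` on `W`, notch widths `D′ ≥ 2` with `N_j·D′(k_i) ≤ |m ± k_iG|` for the multiples `m ∈ Sψ(k_i)` of `N_j`,
and sup bounds `‖A^i_{k_i}T(x)‖ ≤ S(k_i)` for the tracked part `T = Σ_l χ(l)A^{i′}_l b`.  Then
`Σ_{k∈W}‖𝓕(b∘shearMap i i′ (γU_j))(k)‖² ≤ (√(Σ_{n∈F}E_n S_n²) + √(Σ_{n∈F}∫‖A^i_n(b − T)‖²))²` with
`E_n = (√((8/π²)/(D′_n−1)) + |n|G(2e^{1/2}−1)δ_j/N_j)²`. [cite: Grafakos2014, Prop. 3.1.2 (5) and Prop. 3.2.7 (3)] -/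
theorem sum_window_sq_norm_halfStep_twist_L2_le (P : CascadeParams) {G : ℕ} (hγ : P.γ = G) (hδ₀ : 0 < P.δ₀)
    (hd : 0 < P.d) {j : ℕ} (hN : 0 < P.N j) {i i' : Fin 2} (hii' : i ≠ i')
    {b : UnitAddTorus (Fin 2) → ℂ} (hb : Continuous b) (hbs : Summable fun k => ‖mFourierCoeff b k‖)
    (W : Finset (Fin 2 → ℤ)) (χ : ℤ → ℂ) (Sχ : Finset ℤ) (hχS : ∀ l, l ∉ Sχ → χ l = 0) (hχ1 : ∀ l, ‖χ l‖ ≤ 1)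
    (L : ℕ) (hχL : ∀ l, χ l ≠ 0 → |l| < L) (ψ : ℤ → ℤ → ℂ) (Sψ : ℤ → Finset ℤ)
    (hψS : ∀ n m, m ∉ Sψ n → ψ n m = 0) (hψb : ∀ n, ∀ m ∈ Sψ n, ‖ψ n m‖ ≤ 1)
    (hψ1 : ∀ k ∈ W, ∀ l : ℤ, |l| < L → ψ (k i) (k i' - l) = 1)
    (lam' : ℤ → ℤ) (hlam : ∀ k ∈ W, (P.N j : ℤ) * lam' (k i) = k i * G)
    (D' : ℤ → ℕ) (hD' : ∀ k ∈ W, 2 ≤ D' (k i))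
    (hnotch : ∀ k ∈ W, ∀ m ∈ Sψ (k i), (P.N j : ℤ) ∣ m →
      (P.N j : ℤ) * D' (k i) ≤ |m + k i * G| ∧ (P.N j : ℤ) * D' (k i) ≤ |m - k i * G|)
    {S : ℤ → ℝ}
    (hS : ∀ k ∈ W, ∀ x : UnitAddTorus (Fin 2), ‖∫ s : UnitAddCircle, (fourier (-(k i)) s : ℂ) •
      (∑ l ∈ Sχ, χ l * ∫ s' : UnitAddCircle, (fourier (-l) s' : ℂ) • b (x + Pi.single i s + Pi.single i' s'))‖ ≤
        S (k i)) :
    ∑ k ∈ W, ‖mFourierCoeff (b ∘ shearMap i i' (amp ⟨P.U j, P.U_periodic j, P.contDiff_U (P.δ_pos hδ₀ hd j)⟩ P.γ)) k‖ ^ 2 ≤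
      (Real.sqrt (∑ n ∈ W.image (fun k => k i),
          (Real.sqrt (8 / π ^ 2 * (1 / ((D' n : ℝ) - 1))) +
              |(n : ℝ)| * G * ((2 * Real.exp (1 / 2) - 1) * P.δ j / P.N j)) ^ 2 * S n ^ 2) +
        Real.sqrt (∑ n ∈ W.image (fun k => k i), ∫ x : UnitAddTorus (Fin 2),
          ‖∫ s : UnitAddCircle, (fourier (-n) s : ℂ) •
            (b (x + Pi.single i s) - ∑ l ∈ Sχ, χ l * ∫ s' : UnitAddCircle,
              (fourier (-l) s' : ℂ) • b (x + Pi.single i s + Pi.single i' s'))‖ ^ 2)) ^ 2 := by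
  classical
  set Ψ : ShearProfile := amp ⟨P.U j, P.U_periodic j, P.contDiff_U (P.δ_pos hδ₀ hd j)⟩ P.γ with hΨ
  -- the tracked part of the input and the remainder
  set T : UnitAddTorus (Fin 2) → ℂ := fun x => ∑ l ∈ Sχ, χ l *
    ∫ s : UnitAddCircle, (fourier (-l) s : ℂ) • b (x + Pi.single i' s) with hT
  have hTc : Continuous T :=
    continuous_finsetSum _ fun l _ => continuous_const.mul (continuous_twistedAxisAvg hb i' l)
  have hTcoef : ∀ k, mFourierCoeff T k = χ (k i') * mFourierCoeff b k := fun k => mFourierCoeff_axisCutoff hb i' hχS k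
  have hTs : Summable fun k => ‖mFourierCoeff T k‖ := by
    refine Summable.of_nonneg_of_le (fun k => norm_nonneg _) (fun k => ?_) hbs
    rw [hTcoef k, norm_mul]
    exact mul_le_of_le_one_left (norm_nonneg _) (hχ1 _)
  set θ₂ : UnitAddTorus (Fin 2) → ℂ := fun x => b x - T x with hθ₂
  have hθ₂c : Continuous θ₂ := hb.sub hTc
  have hsum : (fun x => T x + θ₂ x) = b := by funext x; simp [hθ₂]
  -- the circle kernels and the twist cut-off
  set kψ : ℤ → UnitAddCircle → ℂ := fun n s => ∑ m ∈ Sψ n, ψ n m * fourier (-m) s with hkψ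
  have hkψc : ∀ n, Continuous (kψ n) := fun n =>
    continuous_finsetSum _ fun m _ => continuous_const.mul (fourier (-m)).continuous
  set gmid : ℤ → UnitAddCircle → ℂ := fun n bb => ∫ s : UnitAddCircle, kψ n s * twist Ψ n (bb + s) with hgmid
  set grest : ℤ → UnitAddCircle → ℂ := fun n bb => twist Ψ n bb - ∫ s : UnitAddCircle, kψ n s * twist Ψ n (bb + s)
    with hgrest
  have hgmidc : ∀ n, Continuous (gmid n) := fun n => continuous_circleCutoff (hkψc n) (continuous_twist Ψ n)
  have hgrestc : ∀ n, Continuous (grest n) := fun n =>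
    (continuous_twist Ψ n).sub (continuous_circleCutoff (hkψc n) (continuous_twist Ψ n))
  have hsplit : ∀ k ∈ W, ∀ bb, twist Ψ (k i) bb = gmid (k i) bb + grest (k i) bb := by
    intro k _ bb; simp only [hgmid, hgrest]; ring
  -- exact separation
  have hsep : ∀ k ∈ W, ∀ m : ℤ, fourierCoeff (grest (k i)) m * mFourierCoeff T (k - Pi.single i' m) = 0 := by
    intro k hk m
    rw [hTcoef]
    have e0 : (k - Pi.single i' m : Fin 2 → ℤ) i' = k i' - m := by simp
    rw [e0]
    by_cases hχ0 : χ (k i' - m) = 0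
    · rw [hχ0, zero_mul, mul_zero]
    · have hl : |k i' - m| < L := hχL _ hχ0
      have hψm : ψ (k i) m = 1 := by
        have := hψ1 k hk (k i' - m) hl
        rwa [show k i' - (k i' - m) = m by ring] at this
      have hcoef : fourierCoeff (grest (k i)) m = 0 := by
        simp only [hgrest]
        rw [fourierCoeff_sub_of_continuous (continuous_twist Ψ _)
            (continuous_circleCutoff (hkψc _) (continuous_twist Ψ _)),
          show (fun y : UnitAddCircle => ∫ s : UnitAddCircle, kψ (k i) s * twist Ψ (k i) (y + s)) =
            (fun y : UnitAddCircle => ∫ s : UnitAddCircle, (∑ m' ∈ Sψ (k i), ψ (k i) m' * fourier (-m') s) *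
              twist Ψ (k i) (y + s)) from rfl,
          fourierCoeff_circleCutoff (continuous_twist Ψ _) (hψS (k i)) m, hψm, one_mul, sub_self]
      rw [hcoef, zero_mul]
  -- the mid-band energy from `…ChirpSidebandEnergy`
  set E : ℤ → ℝ := fun n => (Real.sqrt (8 / π ^ 2 * (1 / ((D' n : ℝ) - 1))) +
    |(n : ℝ)| * G * ((2 * Real.exp (1 / 2) - 1) * P.δ j / P.N j)) ^ 2 with hEdef
  have hE : ∀ k ∈ W, ∫ bb : UnitAddCircle, ‖gmid (k i) bb‖ ^ 2 ≤ E (k i) := by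
    intro k hk
    exact integral_norm_sq_circleCutoff_twist_cascade_le P hδ₀ hd hN hγ (k i) (lam' (k i)) (hlam k hk)
      (hψS (k i)) (hψb (k i)) (hD' k hk) (hnotch k hk)
  -- the sup hypothesis, restated for `T`
  have hS' : ∀ k ∈ W, ∀ x : UnitAddTorus (Fin 2),
      ‖∫ s : UnitAddCircle, (fourier (-(k i)) s : ℂ) • T (x + Pi.single i s)‖ ≤ S (k i) := fun k hk x => hS k hk x
  -- the window lemma
  have hmain := sum_window_sq_norm_comp_shearMap_le_fibreL2 hTc hTs hθ₂c hii' Ψ W gmid grest hgmidc hgrestc hsplit hsep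
    (E := E) (S := S) hE hS'
  rw [hsum] at hmain
  exact hmain

end Summit.AnomalousDissipation.AnomalousDissipation.Theorems.SawtoothPulseCascade.K1Window
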